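import Summits.BirchSwinnertonDyer.BirchSwinnertonDyer.Theorems.BiquadraticEisensteinDescentHeegnerTwistCouplingInSupplyQuarticCellPhiHat
import Literature.NumberTheory.EllipticCurves.TwoIsogenySelmerXCubeAddPXRankZero
import Literature.NumberTheory.EllipticCurves.HeathBrown1994.CongruentTwoSelmerMonskyFamilies
import HarnessLib

set_option linter.dupNamespace false -- `Summit.BirchSwinnertonDyer.BirchSwinnertonDyer.Theorems.…` (summit = sub)
set_option autoImplicit false

/-!
# Crux `HeegnerTwistCouplingInSupply` (stmt-BirchSwinnertonDyer-21381) — the QUARTIC cell PROVED: for `X_B : y² = x³ + B x`,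
# `B = p^k q² l²` (`j = 1728`, Kodaira III/III* at `p`), `p ≡ 15 (mod 16)`, `k ∈ {1, 3}`, `q ≡ 3 (mod 8)` with `(q/p) = +1`,
# `l ≡ 5 (mod 8)` with `(l/p) = −1`: `S^{(φ)} ⊆ {1, −p}`, hence (with the `φ̂`-side of `…QuarticCellPhiHat`) `rank X_B(ℚ) = 0`,
# `Ш(X_B/ℚ)[2] = 0`, `corank_{ℤ₂} Sel_{2^∞}(X_B/ℚ) = 0` — UNCONDITIONAL (no named fact)

Route `BiquadraticEisensteinDescent` (cell `pub/bsd-wall`, width seat `bsd-wall-cm-bed-w3` g12; `--supports` 21381, helper). Third of four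
files on the QUARTIC members `X_A : y² = x³ + A x`, `A ∈ {p, p³}`, `p ≡ 3 (mod 4)` (Kodaira III / III* at `p`, `e = 4`, depth-zero
supercuspidal; CM by `ℤ[i]`, `p` inert; root number `−1` exactly for `p ≡ 15 (mod 16)`) of the CM-inert-bad corner of crux 21381. For a
Heegner field `K′ = ℚ(√−ql)` of `N(X_A)` the twist is `X_A^{(−ql)} = X_{A q² l²}`, whose `L(1) ≠ 0` is the `L`-half of the crux's
conclusion; this file supplies `corank_{ℤ₂} Sel_{2^∞}(X_{A q² l²}/ℚ) = 0`, the hypothesis of Burungale–Tian's rank-zero `2`-converse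
(the sequel `…QuarticCorner` assembles). THE CELL: `p ≡ 15 (mod 16)`, `q ≡ 3 (mod 8)` with `(q/p) = +1` (⟺ `(p/q) = −1`), `l ≡ 5 (mod 8)`
with `(l/p) = −1` (⟺ `(p/l) = −1`), `B = p^k q² l²`, `k ∈ {1, 3}` (= the `E_p` cell `{(3,+), (5,−)}` of
`…CornersThreeFacts.exists_cellData_p`, transplanted); vocabulary `twoIsogenySelmerGroup' 0 B = twoIsogenySelmerGroup 0 (−4B) = S^{(φ)}`
(descent on the square-free divisors of `−4B`, Silverman AEC X.4.9).

* §1 ★ `mem_twoIsogenySelmerGroup_phi` — **`S^{(φ)}(X_B) ⊆ {1, −p}`**: `l ∣ d` and `q ∣ d` die by the reduced discriminant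
  (`16 p^k q²` resp. `16 p^k l²`, non-residues as `(p/l) = (p/q) = −1`); of `±{1, 2, p, 2p}` the classes `−1, 2, p, −2p` die `q`-adically
  (`(−1/q) = (2/q) = (p/q) = (−2p/q) = −1` with `q² ∥ B′/d` and `B′/(d q²)` a non-residue: `…QuarticLocal.not_isSoluble_padic_of_nonsquare_of_sq_mul`),
  `−2` dies `p`-adically (`(−2/p) = −1`, `p^k ∥ B′/(−2)`: `…_of_nonsquare_of_dvd` / `…_of_nonsquare_of_cube_mul`), `2p` dies `p`-adically
  (`XCubeAddPX.not_isSoluble_padic_diagonal` for `k = 1`, `…QuarticLocal.not_isSoluble_padic_of_dvd_of_sq_mul` for `k = 3`);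
  `1 = δ(O)` and `−p ≡ −4B = δ(T′)` remain; `card_twoIsogenySelmerGroup_le` / `card_twoIsogenySelmerGroup'_le`: `#S, #S′ ≤ 2`;
* §2 ★ `rank_eq_zero_and_sha_two` — **`rank X_B(ℚ) = 0` and `Ш(X_B/ℚ)[2] = 0`** (counted Kummer sequences
  `two_pow_twoIsogenySelmerRank_add_eq`, AEC X.4.2(a); `forall_mem_sha_two_smul_eq_zero_of_halfModel`, AEC III.6.1 — the engine of
  `…SqrtTwoCell` §3 verbatim); ★ `selmerCorank_two_eq_zero` — **`corank_{ℤ₂} Sel_{2^∞}(X_B/ℚ) = 0`** (Greenberg's identity).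

PARI cross-check (kit j314832, evidence on 21381): 166/166 triples with `p ≡ 15 (mod 16)`, `p ≤ 260`, `q, l ≤ 90` clean; 0/126 at
`p ≡ 7 (mod 16)` (there the class `q` survives `2`-adically). HONEST FRAMING: unconditional arithmetic of one explicit CM family; nothing about
`L`-values here; the crux (all CM `W` of analytic rank one; residual C⁺) and BSD are NOT proved by any of this. THEOREMS ONLY; supports
stmt-BirchSwinnertonDyer-21381.
-/

noncomputable section

open scoped Classical

namespace Summit.BirchSwinnertonDyer.BirchSwinnertonDyer.Theorems.BiquadraticEisensteinDescentHeegnerTwistCouplingInSupplyQuarticCell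

open _root_.WeierstrassCurve Literature.NumberTheory.EllipticCurves
open Literature.NumberTheory.EllipticCurves.HeathBrown1994.Families (jacobiSym_two_eq_neg_one jacobiSym_neg_two_eq_one
  jacobiSym_neg_two_eq_neg_one)
open Summit.BirchSwinnertonDyer.BirchSwinnertonDyer.Theorems.GoldfeldGoodTwists (mordellWeilRank_congr forall_mem_sha_two_congr)
open Summit.BirchSwinnertonDyer.BirchSwinnertonDyer.Theorems.BiquadraticEisensteinDescentHeegnerTwistCouplingInSupplyQuarticLocal
open Summit.BirchSwinnertonDyer.BirchSwinnertonDyer.Theorems.BiquadraticEisensteinDescentHeegnerTwistCouplingInSupplyQuarticCellPhiHat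

/-! ## §1 `S^{(φ)}(X_B) ⊆ {1, −p}` and the two cardinalities -/

section Selmer

variable {p q l k : ℕ}

/-- ★ **`S^{(φ)}(X_B) ⊆ {1, −p}`** — the descent on the divisors of `−4B` (`twoIsogenySelmerGroup 0 (−4B) = twoIsogenySelmerGroup' 0 B`):
`l ∣ d` and `q ∣ d` die by the reduced discriminant, `−1, 2, p, −2p` die `q`-adically, `−2, 2p` die `p`-adically; `1 = δ(O)` and
`−p ≡ −4B = δ(T′)` remain. [cite: SilvermanAEC2009, Prop. X.4.9] -/
theorem mem_twoIsogenySelmerGroup_phi (hp : p.Prime) (hq : q.Prime) (hl : l.Prime) (hp16 : p % 16 = 15) (hq8 : q % 8 = 3)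
    (hl8 : l % 8 = 5) (hJq : jacobiSym (q : ℤ) p = 1) (hJl : jacobiSym (l : ℤ) p = -1) (hk : k = 1 ∨ k = 3) {d : ℤ}
    (h : d ∈ twoIsogenySelmerGroup 0 (-4 * ((p : ℤ) ^ k * q ^ 2 * l ^ 2))) : d = 1 ∨ d = -p := by
  haveI : Fact p.Prime := ⟨hp⟩
  haveI : Fact q.Prime := ⟨hq⟩
  haveI : Fact l.Prime := ⟨hl⟩
  have hqp : q ≠ p := q_ne_p hq hJq
  have hlp : l ≠ p := l_ne_p hl hJl
  have hql : q ≠ l := by omega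
  have hb0 := b_pos (k := k) hp hq hl
  have hb : -4 * ((p : ℤ) ^ k * q ^ 2 * l ^ 2) ≠ 0 := by positivity
  obtain ⟨hsq, hdvd, hloc⟩ := (mem_twoIsogenySelmerGroup_iff hb).mp h
  have hkodd : Odd k := by rcases hk with rfl | rfl <;> decide
  have hkev : Even (k - 1) := by rcases hk with rfl | rfl <;> decide
  have hJpq : jacobiSym (p : ℤ) q = -1 := jacobiSym_p_q hp16 hq8 hJq
  have hJpl : jacobiSym (p : ℤ) l = -1 := jacobiSym_p_l hp16 hl8 hJl
  have hqodd : Odd q := Nat.odd_iff.mpr (by omega)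
  have hp0 : (p : ℤ) ≠ 0 := by exact_mod_cast hp.ne_zero
  have hpk : (p : ℤ) ^ k = p * p ^ (k - 1) := by rw [← pow_succ']; congr 1; omega
  -- Jacobi symbol values
  have hJm1q : jacobiSym (-1 : ℤ) q = -1 := by rw [jacobiSym.at_neg_one hqodd, ZMod.χ₄_nat_three_mod_four (by omega)]
  have hJ2q : jacobiSym (2 : ℤ) q = -1 := jacobiSym_two_eq_neg_one (Or.inl hq8)
  have hJm2q : jacobiSym (-2 : ℤ) q = 1 := jacobiSym_neg_two_eq_one (Or.inr hq8)
  have hJm2p : jacobiSym (-2 : ℤ) p = -1 := jacobiSym_neg_two_eq_neg_one (Or.inr (by omega))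
  have hgl_q : ((l : ℕ) : ℤ).gcd q = 1 := by
    rw [Int.gcd_natCast_natCast]; exact (Nat.coprime_primes hl hq).mpr (Ne.symm hql)
  have hg2l_q : ((2 * l : ℕ) : ℤ).gcd q = 1 := by
    rw [Int.gcd_natCast_natCast]
    exact Nat.Coprime.mul_left ((Nat.coprime_primes Nat.prime_two hq).mpr (by omega)) ((Nat.coprime_primes hl hq).mpr (Ne.symm hql))
  have hg4l_q : ((4 * l : ℕ) : ℤ).gcd q = 1 := by
    rw [Int.gcd_natCast_natCast, show (4 : ℕ) = 2 ^ 2 by norm_num]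
    exact Nat.Coprime.mul_left (Nat.Coprime.pow_left 2 ((Nat.coprime_primes Nat.prime_two hq).mpr (by omega)))
      ((Nat.coprime_primes hl hq).mpr (Ne.symm hql))
  have hg4q_l : ((4 * q : ℕ) : ℤ).gcd l = 1 := by
    rw [Int.gcd_natCast_natCast, show (4 : ℕ) = 2 ^ 2 by norm_num]
    exact Nat.Coprime.mul_left (Nat.Coprime.pow_left 2 ((Nat.coprime_primes Nat.prime_two hl).mpr (by omega)))
      ((Nat.coprime_primes hq hl).mpr hql)
  have hgql_p : ((q * l : ℕ) : ℤ).gcd p = 1 := by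
    rw [Int.gcd_natCast_natCast]
    exact Nat.Coprime.mul_left ((Nat.coprime_primes hq hp).mpr hqp) ((Nat.coprime_primes hl hp).mpr hlp)
  have hJl2q : jacobiSym (((l : ℕ) : ℤ) ^ 2) q = 1 := jacobiSym.sq_one' hgl_q
  have hJpk_q : jacobiSym ((p : ℤ) ^ k) q = -1 := by rw [jacobiSym.pow_left, hJpq, hkodd.neg_one_pow]
  have hJpk1_q : jacobiSym ((p : ℤ) ^ (k - 1)) q = 1 := by rw [jacobiSym.pow_left, hJpq, hkev.neg_one_pow]
  have hnr_q : ∀ x : ℤ, jacobiSym x q = -1 → ¬ IsSquare ((x : ℤ) : ZMod q) := fun x hx =>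
    ZMod.nonsquare_of_jacobiSym_eq_neg_one hx
  have hnr_p : ∀ x : ℤ, jacobiSym x p = -1 → ¬ IsSquare ((x : ℤ) : ZMod p) := fun x hx =>
    ZMod.nonsquare_of_jacobiSym_eq_neg_one hx
  -- `l ∤ d`: reduced discriminant `16 p^k q²`
  have hld : ¬ (l : ℤ) ∣ d := by
    intro hld
    refine not_isSoluble_of_dvd_of_sq_dvd (r := l) (c := -4 * ((p : ℤ) ^ k * q ^ 2)) (by ring) hsq hld hdvd ?_ (hloc.2 l)
    rw [show (-4 * (-4 * ((p : ℤ) ^ k * q ^ 2)) : ℤ) = (p : ℤ) ^ k * ((4 * q : ℕ) : ℤ) ^ 2 by push_cast; ring,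
      jacobiSym.mul_left, jacobiSym.pow_left, hJpl, jacobiSym.sq_one' hg4q_l, hkodd.neg_one_pow]
    norm_num
  -- `q ∤ d`: reduced discriminant `16 p^k l²`
  have hqd : ¬ (q : ℤ) ∣ d := by
    intro hqd
    refine not_isSoluble_of_dvd_of_sq_dvd (r := q) (c := -4 * ((p : ℤ) ^ k * l ^ 2)) (by ring) hsq hqd hdvd ?_ (hloc.2 q)
    rw [show (-4 * (-4 * ((p : ℤ) ^ k * l ^ 2)) : ℤ) = (p : ℤ) ^ k * ((4 * l : ℕ) : ℤ) ^ 2 by push_cast; ring,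
      jacobiSym.mul_left, hJpk_q, jacobiSym.sq_one' hg4l_q]
    norm_num
  -- the square-free part: `|d| ∈ {1, 2, p, 2p}`
  have habs := eq_of_squarefree_dvd_phi hp hq hl (k := k) hsq hld hqd hdvd
  have hp2Z : ¬ (p : ℤ) ∣ 2 := fun h2 =>
    (show p ≠ 2 by omega) ((Nat.prime_dvd_prime_iff_eq hp Nat.prime_two).mp (Int.natCast_dvd_natCast.mp h2))
  have hpql : ¬ (p : ℤ) ∣ 2 * (q : ℤ) ^ 2 * l ^ 2 :=
    not_dvd_prime_mul hp hq hl hqp.symm hlp.symm (by omega) (a := 2) (b := 2) (Or.inr (Or.inr rfl))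
  rcases Int.natAbs_eq d with hpos | hneg
  · rcases habs with h1 | h2 | h3 | h4
    · left; omega
    · -- `d = 2`: dies at `q` (`(2/q) = −1`, `B′/2 = q²·(−2 p^k l²)`)
      exfalso
      have hd2 : d = 2 := by omega
      subst hd2
      have hdiv : -4 * ((p : ℤ) ^ k * q ^ 2 * l ^ 2) / 2 = (q : ℤ) ^ 2 * (-2 * (p : ℤ) ^ k * l ^ 2) :=
        Int.ediv_eq_of_eq_mul_right two_ne_zero (by ring)
      have h2 := hloc.2 q
      rw [hdiv] at h2
      refine not_isSoluble_padic_of_nonsquare_of_sq_mul rfl (hnr_q 2 hJ2q) (hnr_q _ ?_) h2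
      rw [jacobiSym.mul_left, jacobiSym.mul_left, hJm2q, hJpk_q, hJl2q]
      norm_num
    · -- `d = p`: dies at `q` (`(p/q) = −1`, `B′/p = q²·(−4 p^{k−1} l²)`)
      exfalso
      have hdp : d = p := by omega
      subst hdp
      have hdiv : -4 * ((p : ℤ) ^ k * q ^ 2 * l ^ 2) / p = (q : ℤ) ^ 2 * (-4 * (p : ℤ) ^ (k - 1) * l ^ 2) :=
        Int.ediv_eq_of_eq_mul_right hp0 (by rw [hpk]; ring)
      have h2 := hloc.2 q
      rw [hdiv] at h2
      refine not_isSoluble_padic_of_nonsquare_of_sq_mul rfl (hnr_q p hJpq) (hnr_q _ ?_) h2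
      rw [show (-4 * (p : ℤ) ^ (k - 1) * l ^ 2 : ℤ) = -1 * (p : ℤ) ^ (k - 1) * ((2 * l : ℕ) : ℤ) ^ 2 by push_cast; ring,
        jacobiSym.mul_left, jacobiSym.mul_left, hJm1q, hJpk1_q, jacobiSym.sq_one' hg2l_q]
      norm_num
    · -- `d = 2p`: dies at `p` (`(−2/p) = −1`)
      exfalso
      have hd2p : d = 2 * p := by omega
      subst hd2p
      have h2 := hloc.2 p
      have hnr : ¬ IsSquare (((-2 * (q : ℤ) ^ 2 * l ^ 2 : ℤ) : ℤ) : ZMod p) := by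
        refine hnr_p _ ?_
        rw [show (-2 * (q : ℤ) ^ 2 * l ^ 2 : ℤ) = -2 * ((q * l : ℕ) : ℤ) ^ 2 by push_cast; ring, jacobiSym.mul_left, hJm2p,
          jacobiSym.sq_one' hgql_p]
        norm_num
      rcases hk with rfl | rfl
      · -- `k = 1`: `B′/(2p) = −2 q² l²`, `p ∥ 2p`
        have hdiv : -4 * ((p : ℤ) ^ 1 * q ^ 2 * l ^ 2) / (2 * p) = -2 * (q : ℤ) ^ 2 * l ^ 2 :=
          Int.ediv_eq_of_eq_mul_right (mul_ne_zero two_ne_zero hp0) (by ring)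
        rw [hdiv] at h2
        refine XCubeAddPX.not_isSoluble_padic_diagonal (p := p) (A := 2 * p) (E := -2 * (q : ℤ) ^ 2 * l ^ 2) ⟨2, by ring⟩ ?_ hnr h2
        rintro ⟨c, hc⟩
        exact hp2Z ⟨c, mul_left_cancel₀ hp0 (by linear_combination hc)⟩
      · -- `k = 3`: `B′/(2p) = p²·(−2 q² l²)`, `p ∥ 2p`
        have hdiv : -4 * ((p : ℤ) ^ 3 * q ^ 2 * l ^ 2) / (2 * p) = (p : ℤ) ^ 2 * (-2 * (q : ℤ) ^ 2 * l ^ 2) :=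
          Int.ediv_eq_of_eq_mul_right (mul_ne_zero two_ne_zero hp0) (by ring)
        rw [hdiv] at h2
        exact not_isSoluble_padic_of_dvd_of_sq_mul (d₁ := 2) (by ring) hp2Z rfl hnr h2
  · rcases habs with h1 | h2 | h3 | h4
    · -- `d = −1`: dies at `q` (`(−1/q) = −1`, `B′/(−1) = q²·(4 p^k l²)`)
      exfalso
      have hdm1 : d = -1 := by omega
      subst hdm1
      have hdiv : -4 * ((p : ℤ) ^ k * q ^ 2 * l ^ 2) / (-1) = (q : ℤ) ^ 2 * (4 * (p : ℤ) ^ k * l ^ 2) := by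
        rw [Int.ediv_neg, Int.ediv_one]; ring
      have h2 := hloc.2 q
      rw [hdiv] at h2
      refine not_isSoluble_padic_of_nonsquare_of_sq_mul rfl (hnr_q (-1) hJm1q) (hnr_q _ ?_) h2
      rw [show (4 * (p : ℤ) ^ k * l ^ 2 : ℤ) = (p : ℤ) ^ k * ((2 * l : ℕ) : ℤ) ^ 2 by push_cast; ring,
        jacobiSym.mul_left, hJpk_q, jacobiSym.sq_one' hg2l_q]
      norm_num
    · -- `d = −2`: dies at `p` (`(−2/p) = −1`, `B′/(−2) = p^k · 2 q² l²`)
      exfalso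
      have hdm2 : d = -2 := by omega
      subst hdm2
      have h2 := hloc.2 p
      rcases hk with rfl | rfl
      · have hdiv : -4 * ((p : ℤ) ^ 1 * q ^ 2 * l ^ 2) / (-2) = (p : ℤ) * (2 * (q : ℤ) ^ 2 * l ^ 2) :=
          Int.ediv_eq_of_eq_mul_right (by norm_num) (by ring)
        rw [hdiv] at h2
        exact not_isSoluble_padic_of_nonsquare_of_dvd rfl hpql (hnr_p (-2) hJm2p) h2
      · have hdiv : -4 * ((p : ℤ) ^ 3 * q ^ 2 * l ^ 2) / (-2) = (p : ℤ) ^ 3 * (2 * (q : ℤ) ^ 2 * l ^ 2) :=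
          Int.ediv_eq_of_eq_mul_right (by norm_num) (by ring)
        rw [hdiv] at h2
        exact not_isSoluble_padic_of_nonsquare_of_cube_mul rfl hpql (hnr_p (-2) hJm2p) h2
    · right; omega
    · -- `d = −2p`: dies at `q` (`(−2p/q) = −1`, `B′/(−2p) = q²·(2 p^{k−1} l²)`)
      exfalso
      have hd2p : d = -(2 * p) := by omega
      subst hd2p
      have hdiv : -4 * ((p : ℤ) ^ k * q ^ 2 * l ^ 2) / (-(2 * p)) = (q : ℤ) ^ 2 * (2 * (p : ℤ) ^ (k - 1) * l ^ 2) :=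
        Int.ediv_eq_of_eq_mul_right (neg_ne_zero.mpr (mul_ne_zero two_ne_zero hp0)) (by rw [hpk]; ring)
      have h2 := hloc.2 q
      rw [hdiv] at h2
      refine not_isSoluble_padic_of_nonsquare_of_sq_mul rfl (hnr_q _ ?_) (hnr_q _ ?_) h2
      · rw [show (-(2 * (p : ℤ)) : ℤ) = -2 * p by ring, jacobiSym.mul_left, hJm2q, hJpq]; norm_num
      · rw [jacobiSym.mul_left, jacobiSym.mul_left, hJ2q, hJpk1_q, hJl2q]
        norm_num

/-- `S′(0, B) = S(0, −4B)`. [folklore] -/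
theorem twoIsogenySelmerGroup'_zero (B : ℤ) : twoIsogenySelmerGroup' 0 B = twoIsogenySelmerGroup 0 (-4 * B) := by
  rw [twoIsogenySelmerGroup'_eq]; congr 1; ring

/-- `#S(0, B) ≤ 2` in the cell. [cite: SilvermanAEC2009, Prop. X.4.9] -/
theorem card_twoIsogenySelmerGroup_le (hp : p.Prime) (hq : q.Prime) (hl : l.Prime) (hp16 : p % 16 = 15) (hq8 : q % 8 = 3)
    (hl8 : l % 8 = 5) (hJl : jacobiSym (l : ℤ) p = -1) (hk : k = 1 ∨ k = 3) :
    (twoIsogenySelmerGroup 0 ((p : ℤ) ^ k * q ^ 2 * l ^ 2)).card ≤ 2 :=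
  le_trans (Finset.card_le_card fun d hd => by
    have := mem_twoIsogenySelmerGroup_phiHat hp hq hl hp16 hq8 hl8 hJl hk hd
    simp only [Finset.mem_insert, Finset.mem_singleton]
    exact this) (Finset.card_le_two (a := (1 : ℤ)) (b := (p : ℤ)))

/-- `#S′(0, B) ≤ 2` in the cell. [cite: SilvermanAEC2009, Prop. X.4.9] -/
theorem card_twoIsogenySelmerGroup'_le (hp : p.Prime) (hq : q.Prime) (hl : l.Prime) (hp16 : p % 16 = 15) (hq8 : q % 8 = 3)
    (hl8 : l % 8 = 5) (hJq : jacobiSym (q : ℤ) p = 1) (hJl : jacobiSym (l : ℤ) p = -1) (hk : k = 1 ∨ k = 3) :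
    (twoIsogenySelmerGroup' 0 ((p : ℤ) ^ k * q ^ 2 * l ^ 2)).card ≤ 2 := by
  rw [twoIsogenySelmerGroup'_zero]
  exact le_trans (Finset.card_le_card fun d hd => by
    have := mem_twoIsogenySelmerGroup_phi hp hq hl hp16 hq8 hl8 hJq hJl hk hd
    simp only [Finset.mem_insert, Finset.mem_singleton]
    exact this) (Finset.card_le_two (a := (1 : ℤ)) (b := -(p : ℤ)))

end Selmer

/-! ## §2 `rank X_B(ℚ) = 0`, `Ш(X_B/ℚ)[2] = 0`, `corank_{ℤ₂} Sel_{2^∞}(X_B/ℚ) = 0` -/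

section RankZero

variable {p q l k : ℕ}

/-- Arithmetic core: `m = 2^{r+2} (n₁ n₂) ≤ 4`, `m > 0` ⇒ `r = 0` and `n₁ = n₂ = 1`. [folklore] -/
private theorem rank_zero_arith {r n₁ n₂ m : ℕ} (hm : m = 2 ^ (r + 2) * (n₁ * n₂)) (hm4 : m ≤ 4)
    (hmpos : 0 < m) : r = 0 ∧ n₁ = 1 ∧ n₂ = 1 := by
  subst hm
  have hn₁ : 0 < n₁ := Nat.pos_of_ne_zero (by rintro rfl; simp at hmpos)
  have hn₂ : 0 < n₂ := Nat.pos_of_ne_zero (by rintro rfl; simp at hmpos)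
  have h2 : 2 ^ (r + 2) ≤ 4 := le_trans (Nat.le_mul_of_pos_right _ (Nat.mul_pos hn₁ hn₂)) hm4
  have hr : r = 0 := by
    by_contra hr
    have h8 : 2 ^ 3 ≤ 2 ^ (r + 2) := Nat.pow_le_pow_right (by norm_num) (by omega)
    omega
  subst hr
  norm_num at hm4
  refine ⟨rfl, ?_, ?_⟩ <;> nlinarith

/-- `B (0² − 4B) = −4B² ≠ 0` for `B ≠ 0`. [folklore] -/
theorem hab_X {B : ℤ} (hB : B ≠ 0) : B * ((0 : ℤ) ^ 2 - 4 * B) ≠ 0 := by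
  rw [show B * ((0 : ℤ) ^ 2 - 4 * B) = -4 * B ^ 2 by ring]
  exact mul_ne_zero (by norm_num) (pow_ne_zero 2 hB)

/-- `X_B` is an elliptic curve for `B ≠ 0` (`Δ = −64 B³`; the tree's cast literal `E_{0, B} = ⟨0, ↑0, 0, ↑B, 0⟩` is `X_B`, cf.
`…QuarticTwistCorner.lit_eq` of bed-w4 g13). [cite: SilvermanAEC2009, Prop. X.4.9] -/
theorem isElliptic_X {B : ℤ} (hB : B ≠ 0) : (⟨0, 0, 0, (B : ℚ), 0⟩ : WeierstrassCurve ℚ).IsElliptic := by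
  have hlit : (⟨0, ((0 : ℤ) : ℚ), 0, (B : ℚ), 0⟩ : WeierstrassCurve ℚ) = ⟨0, 0, 0, (B : ℚ), 0⟩ := by
    ext <;> push_cast <;> rfl
  rw [← hlit]
  exact isElliptic_mk_of_ne_zero (F := ℚ) (hab_X hB)

/-- ★ **THE QUARTIC CELL: `rank X_B(ℚ) = 0` and `Ш(X_B/ℚ)[2] = 0`** for `X_B : y² = x³ + B x`, `B = p^k q² l²`, `p ≡ 15 (mod 16)`,
`k ∈ {1, 3}`, `q ≡ 3 (mod 8)` with `(q/p) = +1`, `l ≡ 5 (mod 8)` with `(l/p) = −1` — UNCONDITIONAL: the counted Kummer sequences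
`#S·#S′ = 2^{rank+2}·#Ш(X′)[φ̂]·#Ш(X)[φ]` (`two_pow_twoIsogenySelmerRank_add_eq`, AEC X.4.2(a)) with `#S, #S′ ≤ 2` force `rank = 0`
and both `φ`-parts trivial, whence `Ш[2] = 0` (`forall_mem_sha_two_smul_eq_zero_of_halfModel`, AEC III.6.1). PARI: 166/166 (kit j314832).
[cite: SilvermanAEC2009, Thm. X.4.2(a), Prop. X.4.9, Example X.4.10] -/
theorem rank_eq_zero_and_sha_two (hp : p.Prime) (hq : q.Prime) (hl : l.Prime) (hp16 : p % 16 = 15) (hq8 : q % 8 = 3)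
    (hl8 : l % 8 = 5) (hJq : jacobiSym (q : ℤ) p = 1) (hJl : jacobiSym (l : ℤ) p = -1) (hk : k = 1 ∨ k = 3) :
    (⟨0, 0, 0, (((p : ℤ) ^ k * q ^ 2 * l ^ 2 : ℤ) : ℚ), 0⟩ : WeierstrassCurve ℚ).mordellWeilRank = 0 ∧
      ∀ c ∈ (⟨0, 0, 0, (((p : ℤ) ^ k * q ^ 2 * l ^ 2 : ℤ) : ℚ), 0⟩ : WeierstrassCurve ℚ).sha, 2 • c = 0 → c = 0 := by
  set B : ℤ := (p : ℤ) ^ k * q ^ 2 * l ^ 2 with hB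
  have hB0 : B ≠ 0 := (b_pos (k := k) hp hq hl).ne'
  have hab := hab_X hB0
  haveI := isElliptic_halfModel hab
  haveI := isElliptic_mk_of_ne_zero (F := ℚ) hab
  haveI := isElliptic_X hB0
  have key := two_pow_twoIsogenySelmerRank_add_eq hab
  have h4 : 2 ^ (twoIsogenySelmerRank 0 B + twoIsogenySelmerRank' 0 B) ≤ 4 := by
    rw [pow_add, two_pow_twoIsogenySelmerRank_eq_card hab, two_pow_twoIsogenySelmerRank'_eq_card hab]
    exact Nat.mul_le_mul (card_twoIsogenySelmerGroup_le hp hq hl hp16 hq8 hl8 hJl hk)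
      (card_twoIsogenySelmerGroup'_le hp hq hl hp16 hq8 hl8 hJq hJl hk)
  obtain ⟨hr, h₁, h₂⟩ := rank_zero_arith key h4 (pow_pos two_pos _)
  have hsha := forall_mem_sha_two_smul_eq_zero_of_halfModel (AddSubgroup.eq_bot_of_card_eq _ h₁)
    (AddSubgroup.eq_bot_of_card_eq _ h₂)
  have hlit : (⟨0, ((0 : ℤ) : ℚ), 0, (B : ℚ), 0⟩ : WeierstrassCurve ℚ) = ⟨0, 0, 0, (B : ℚ), 0⟩ := by
    ext <;> push_cast <;> rfl
  refine ⟨?_, forall_mem_sha_two_congr hlit.symm hsha⟩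
  rw [← mordellWeilRank_congr hlit]
  exact hr

/-- ★ **THE QUARTIC CELL, corank form: `corank_{ℤ₂} Sel_{2^∞}(X_B/ℚ) = 0`** (same data): `corank Sel = rank + corank Ш[2^∞]`
(Greenberg, tree theorem `selmerCorank_eq_mordellWeilRank_add_holds`) with `rank = 0` and `Ш[2] = 0 ⇒ corank Ш[2^∞] = 0`
(`shaCorank_eq_zero_of_forall`). This is the hypothesis of Burungale–Tian's rank-zero `2`-converse. The instance argument is
`isElliptic_X`. [cite: SilvermanAEC2009, Thm. X.4.2(a) and Prop. X.4.9] [cite: Greenberg1999, §1] -/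
theorem selmerCorank_two_eq_zero (hp : p.Prime) (hq : q.Prime) (hl : l.Prime) (hp16 : p % 16 = 15) (hq8 : q % 8 = 3)
    (hl8 : l % 8 = 5) (hJq : jacobiSym (q : ℤ) p = 1) (hJl : jacobiSym (l : ℤ) p = -1) (hk : k = 1 ∨ k = 3)
    [hE : (⟨0, 0, 0, (((p : ℤ) ^ k * q ^ 2 * l ^ 2 : ℤ) : ℚ), 0⟩ : WeierstrassCurve ℚ).IsElliptic] :
    (⟨0, 0, 0, (((p : ℤ) ^ k * q ^ 2 * l ^ 2 : ℤ) : ℚ), 0⟩ : WeierstrassCurve ℚ).selmerCorank 2 = 0 := by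
  haveI : Fact (Nat.Prime 2) := ⟨Nat.prime_two⟩
  obtain ⟨hr, hsha⟩ := rank_eq_zero_and_sha_two hp hq hl hp16 hq8 hl8 hJq hJl hk
  rw [(⟨0, 0, 0, (((p : ℤ) ^ k * q ^ 2 * l ^ 2 : ℤ) : ℚ), 0⟩ : WeierstrassCurve ℚ).selmerCorank_eq_mordellWeilRank_add_holds 2,
    hr, (⟨0, 0, 0, (((p : ℤ) ^ k * q ^ 2 * l ^ 2 : ℤ) : ℚ), 0⟩ : WeierstrassCurve ℚ).shaCorank_eq_zero_of_forall 2 hsha]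

end RankZero

end Summit.BirchSwinnertonDyer.BirchSwinnertonDyer.Theorems.BiquadraticEisensteinDescentHeegnerTwistCouplingInSupplyQuarticCell

end
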